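import Mathlib

/-!
# Hot-moment invisibility of a (near-)degenerate vacuum — ideator ym-ir-idea-17 g2 (lens `dual`), memo `Cruxes/IRcof/DUAL-CENSUS-idea17-g2.md` §1(2)

Group-free, model-free toy (GUIDANCE for the Barriers harvest; nothing here is about Yang–Mills): the two integer-multiplicity
spectral data  ν₁ = δ₁ + M·δ_q  («vacuum + a bulk of M states at activity q») and  ν₂ = 2·δ₁ + M·δ_q  («same bulk, vacuum doubled»)
have thermal moments  m₁(τ) = 1 + M q^τ,  m₂(τ) = 2 + M q^τ.  We prove:

* `ratio_sub_one_eq` / `ratio_sub_one_le` : for every hot horizon `k`, all `τ ≤ k` satisfy `0 ≤ m₂(τ)/m₁(τ) − 1 ≤ 1/(1 + M q^k)` — the two data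
  agree on ALL hot moments to any prescribed relative precision once the bulk `M q^k` is large (the vacuum is invisible in hot moments);
* `purity₁_tendsto_one` / `purity₂_tendsto_half` : the cold purities `m(2t)/m(t)²` tend to `1` resp. `1/2` as `t → ∞` (`0 ≤ q < 1`).

Hence no functional of finitely many hot moments that is stable under small relative perturbation (every LP ∕ SDP ∕ rank-with-tolerance
certificate is) can certify cold purity `≥ 23/24`: memo §1(2) «B-DUAL-HOT-INVISIBILITY».  Thermal-moment sibling of
`Cruxes.IR.AspectBootstrap.Ceiling.not_abstractBasin_half` (Theorems/BalabanLadderIRAbstractBasinCeiling.lean).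

HONEST FRAMING. Nothing here proves the Yang–Mills mass gap (Clay), a lattice gap, `BalabanLadder.IR`/`IRcof`, PX or PXcof; it is a NEGATIVE ∕ located
obstruction for the `dual` lens.  R4 closes only the conditional finite-𝕋⁴ rung `BalabanLadder.UV`.
-/

noncomputable section

open Filter Topology

namespace Summit.QuantumFields.YangMills.Cruxes.IRcof.DualInvisibility

/-- Thermal moments of `ν₁ = δ₁ + M·δ_q`. -/
def m₁ (M q : ℝ) (τ : ℕ) : ℝ := 1 + M * q ^ τ

/-- Thermal moments of `ν₂ = 2·δ₁ + M·δ_q`. -/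
def m₂ (M q : ℝ) (τ : ℕ) : ℝ := 2 + M * q ^ τ

/-- Cold purity at period `t` of a moment sequence: `m(2t)/m(t)²` ( = `Z(L³×2t)/Z(L³×t)²` in the dictionary). -/
def purity (m : ℕ → ℝ) (t : ℕ) : ℝ := m (2 * t) / m t ^ 2

theorem m₁_pos {M q : ℝ} (hM : 0 ≤ M) (hq : 0 ≤ q) (τ : ℕ) : 0 < m₁ M q τ := by
  unfold m₁; positivity

theorem m₂_pos {M q : ℝ} (hM : 0 ≤ M) (hq : 0 ≤ q) (τ : ℕ) : 0 < m₂ M q τ := by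
  unfold m₂; positivity

/-- The hot-moment ratio minus one is exactly the vacuum's thermal weight in `ν₁`. -/
theorem ratio_sub_one_eq {M q : ℝ} (hM : 0 ≤ M) (hq : 0 ≤ q) (τ : ℕ) :
    m₂ M q τ / m₁ M q τ - 1 = 1 / (1 + M * q ^ τ) := by
  have h : 0 < 1 + M * q ^ τ := by positivity
  unfold m₁ m₂
  field_simp
  ring

theorem ratio_sub_one_nonneg {M q : ℝ} (hM : 0 ≤ M) (hq : 0 ≤ q) (τ : ℕ) :
    0 ≤ m₂ M q τ / m₁ M q τ - 1 := by
  rw [ratio_sub_one_eq hM hq]; positivity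

/-- HOT INVISIBILITY, uniform on the hot horizon: for `τ ≤ k` and `0 ≤ q ≤ 1`,
`m₂(τ)/m₁(τ) − 1 ≤ 1/(1 + M q^k)` — as small as desired once the bulk `M q^k` is large. -/
theorem ratio_sub_one_le {M q : ℝ} (hM : 0 ≤ M) (hq : 0 ≤ q) (hq1 : q ≤ 1) {τ k : ℕ} (hτ : τ ≤ k) :
    m₂ M q τ / m₁ M q τ - 1 ≤ 1 / (1 + M * q ^ k) := by
  rw [ratio_sub_one_eq hM hq]
  have hk : 0 < 1 + M * q ^ k := by positivity
  have hqτ : q ^ k ≤ q ^ τ := pow_le_pow_of_le_one hq hq1 hτ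
  have hle : 1 + M * q ^ k ≤ 1 + M * q ^ τ := by nlinarith [mul_le_mul_of_nonneg_left hqτ hM]
  exact one_div_le_one_div_of_le hk hle

/-- For fixed `τ`, the hot-moment ratio tends to `1` as the bulk multiplicity `M → ∞` (`0 < q`). -/
theorem ratio_tendsto_one {q : ℝ} (hq : 0 < q) (τ : ℕ) :
    Tendsto (fun M : ℝ => m₂ M q τ / m₁ M q τ) atTop (𝓝 1) := by
  have hqτ : 0 < q ^ τ := pow_pos hq τ
  -- `1 + M q^τ → ∞`, hence `1/(1 + M q^τ) → 0`
  have h1 : Tendsto (fun M : ℝ => 1 + M * q ^ τ) atTop atTop :=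
    tendsto_atTop_add_const_left _ _ (Tendsto.atTop_mul_const hqτ tendsto_id)
  have h2 : Tendsto (fun M : ℝ => (1 + M * q ^ τ)⁻¹) atTop (𝓝 0) := h1.inv_tendsto_atTop
  have h3 : Tendsto (fun M : ℝ => 1 + (1 + M * q ^ τ)⁻¹) atTop (𝓝 (1 + 0)) :=
    tendsto_const_nhds.add h2
  rw [add_zero] at h3
  refine h3.congr' ?_
  filter_upwards [eventually_ge_atTop (0 : ℝ)] with M hM
  have := ratio_sub_one_eq hM hq.le τ
  rw [one_div] at this
  linarith

/-- Auxiliary: `q^(2t) → 0` and `q^t → 0` along `t → ∞` for `0 ≤ q < 1`. -/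
theorem pow_two_mul_tendsto_zero {q : ℝ} (hq : 0 ≤ q) (hq1 : q < 1) :
    Tendsto (fun t : ℕ => q ^ (2 * t)) atTop (𝓝 0) := by
  have h : Tendsto (fun t : ℕ => (q ^ 2) ^ t) atTop (𝓝 0) :=
    tendsto_pow_atTop_nhds_zero_of_lt_one (by positivity) (by nlinarith)
  refine h.congr ?_
  intro t; rw [pow_mul]

/-- COLD SEPARATION (i): the purity of `ν₁` tends to `1`. -/
theorem purity₁_tendsto_one {M q : ℝ} (hq : 0 ≤ q) (hq1 : q < 1) :
    Tendsto (fun t : ℕ => purity (m₁ M q) t) atTop (𝓝 1) := by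
  have hA : Tendsto (fun t : ℕ => 1 + M * q ^ (2 * t)) atTop (𝓝 (1 + M * 0)) :=
    tendsto_const_nhds.add (tendsto_const_nhds.mul (pow_two_mul_tendsto_zero hq hq1))
  have hB : Tendsto (fun t : ℕ => (1 + M * q ^ t) ^ 2) atTop (𝓝 ((1 + M * 0) ^ 2)) :=
    (tendsto_const_nhds.add (tendsto_const_nhds.mul (tendsto_pow_atTop_nhds_zero_of_lt_one hq hq1))).pow 2
  simp only [mul_zero, add_zero, one_pow] at hA hB
  have h := hA.mul (hB.inv₀ one_ne_zero)
  rw [inv_one, mul_one] at h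
  exact h.congr (fun t => by simp [purity, m₁, div_eq_mul_inv])

/-- COLD SEPARATION (ii): the purity of `ν₂` tends to `1/2`. -/
theorem purity₂_tendsto_half {M q : ℝ} (hq : 0 ≤ q) (hq1 : q < 1) :
    Tendsto (fun t : ℕ => purity (m₂ M q) t) atTop (𝓝 (1 / 2)) := by
  have hA : Tendsto (fun t : ℕ => 2 + M * q ^ (2 * t)) atTop (𝓝 (2 + M * 0)) :=
    tendsto_const_nhds.add (tendsto_const_nhds.mul (pow_two_mul_tendsto_zero hq hq1))
  have hB : Tendsto (fun t : ℕ => (2 + M * q ^ t) ^ 2) atTop (𝓝 ((2 + M * 0) ^ 2)) :=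
    (tendsto_const_nhds.add (tendsto_const_nhds.mul (tendsto_pow_atTop_nhds_zero_of_lt_one hq hq1))).pow 2
  simp only [mul_zero, add_zero] at hA hB
  have h := hA.mul (hB.inv₀ (by norm_num))
  have h' : (2 : ℝ) * ((2 : ℝ) ^ 2)⁻¹ = 1 / 2 := by norm_num
  rw [h'] at h
  exact h.congr (fun t => by simp [purity, m₂, div_eq_mul_inv])

/-- The packaged invisibility statement: for every hot horizon `k` and tolerance `ε > 0` there is a bulk size `M` such that the two data agree
on every hot moment `τ ≤ k` to relative precision `ε`, while (independently of `M`) their cold purities tend to `1` and `1/2`. -/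
theorem hot_moment_invisibility {q : ℝ} (hq : 0 < q) (hq1 : q < 1) (k : ℕ) {ε : ℝ} (hε : 0 < ε) :
    ∃ M : ℝ, 0 ≤ M ∧ (∀ τ ≤ k, |m₂ M q τ / m₁ M q τ - 1| ≤ ε) ∧
      Tendsto (fun t : ℕ => purity (m₁ M q) t) atTop (𝓝 1) ∧
      Tendsto (fun t : ℕ => purity (m₂ M q) t) atTop (𝓝 (1 / 2)) := by
  have hqk : 0 < q ^ k := pow_pos hq k
  refine ⟨1 / (ε * q ^ k), by positivity, ?_, purity₁_tendsto_one hq.le hq1, purity₂_tendsto_half hq.le hq1⟩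
  intro τ hτ
  rw [abs_of_nonneg (ratio_sub_one_nonneg (by positivity) hq.le τ)]
  refine (ratio_sub_one_le (by positivity) hq.le hq1.le hτ).trans ?_
  have hMq : 1 / (ε * q ^ k) * q ^ k = 1 / ε := by
    field_simp
  rw [hMq]
  have : 1 + 1 / ε = (ε + 1) / ε := by field_simp
  rw [this, one_div_div]
  have hε1 : 0 < ε + 1 := by linarith
  rw [div_le_iff₀ hε1]
  nlinarith

end Summit.QuantumFields.YangMills.Cruxes.IRcof.DualInvisibility

end
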